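import Summits.AtomisticToContinuum.HydrodynamicLimit.Theorems.RelayRaceLocalityNearConstantShortTimeHLOrbitExpansion
import Summits.AtomisticToContinuum.HydrodynamicLimit.Theorems.RelayRaceLocalityNearConstantShortTimeHLOrbitIntegrability
import Summits.AtomisticToContinuum.HydrodynamicLimit.Theorems.RelayRaceLocalityNearConstantShortTimeHLDerivContinuity
import Summits.AtomisticToContinuum.HydrodynamicLimit.Theorems.RelayRaceLocalityNearConstantShortTimeHLDefectLinearity
import HarnessLib

/-!
# Crux `NearConstantShortTimeHL` (stmt-AtomisticToContinuum-12502), line `small-tilt-domination`: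
# stub `weightedCell_bound` — part A: the time-weighted tests and the balance-row integrands

Support file (lead c4) for the registered stub `weightedCell_bound` of the Grönwall assembly of the crux
`…Theses.RelayRaceLocality.NearConstantShortTimeHL` (route: Yau's relative-entropy method for
deterministic hard spheres, Grönwall discretised on time cells; the stub itself is proved in
`…WeightedCell.lean`, which imports this file).  The cell bound integrates the three weak balance rows
along a hard-sphere orbit against the TIME-WEIGHTED log-profile rows `(s+τ−r)λ⁰_r`, `(s+τ−r)•λ_r`,
`(s+τ−r)λ⁴_r`; this file supplies the calculus of these tests and the pointwise-in-time bookkeeping: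

* `xs_weighted` / `xs_weighted_mul` — for a row `f` jointly smooth on `[0, t') × 𝕋³` (`t' ≤ T`) the
  weighted row is jointly smooth on the window `[s, s+τ] × 𝕋³`, with the product rule
  `∂ₜ^{[s,s+τ]}((s+τ−r)f) = −f + (s+τ−r)∂ₜ^{[0,T)}f` (`HasDerivWithinAt.smul`,
  `timeDerivWithin_Ico_eq_of_le`), smooth slices and window derivatives jointly continuous on the
  slab (the admissibility data of `intervalIntegrable_momFlux_orbit` / `intervalIntegrable_enFlux_orbit`);
* `xs_slab`, `xs_ii_density` / `xs_ii_momentum` / `xs_ii_energy` — slab continuity of a row and its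
  derivatives, and interval integrability of the raw pairings `ρ_{Φ_r z}[f_r]`, `Σⱼ(m_{Φ_r z}[g_{j,r}])ⱼ`,
  `e_{Φ_r z}[f_r]` along a good orbit (`intervalIntegrable_sum_orbit`);
* `weightedCell_massRow` (registered) — the MASS ROW with the weighted scalar test, exact (`wc_densityRow`):
  `0 − τρ_{Φ_s z}[λ⁰_s] = ∫_s^{s+τ} (−ρ[λ⁰_r] + (s+τ−r)(ρ[∂ₜλ⁰_r] + Σₖ(m[∂ₖλ⁰_r])ₖ)) dr`;
* `xs_mom_integrand`, `xs_en_integrand` — the time integrands of `momDefect` / `enDefect` for a test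
  `ψ_r = c•λ_r` with `∂ₜψ_r = −λ_r + c•∂ₜλ_r`, rewritten as `−(raw row) + c·(raw ∂ₜ-row + ∫ flux(λ_r))`
  (linearity of the pairings, `∂ᵢ(c•λ) = c•∂ᵢλ`, `div(c•λ) = c div λ`, `∇(cλ⁴) = c∇λ⁴`).

No definitions, no named facts.  References: H.-T. Yau, Lett. Math. Phys. 22 (1991) §2; H. Spohn,
*Large Scale Dynamics of Interacting Particles* (1991), Part I §3.
-/

noncomputable section

namespace Summit.AtomisticToContinuum.HydrodynamicLimit.Theorems.NearConstantShortTimeHL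

open scoped BigOperators ENNReal Topology
open MeasureTheory Set Filter
open Literature.MathematicalPhysics.KineticTheory Literature.Analysis.FluidPDE Literature.Analysis.FunctionSpaces

/-! ### The time-weighted tests -/

/-- A time-weighted row `(r, y) ↦ (c - r) • f r y` is jointly smooth on any time set on which `f` is
(the affine weight has the smooth space–time lift `p ↦ c - p.1`, cf. `xe_isSmoothSpaceTimeOn_weight`).
[folklore] -/
theorem xs_weightedRow_smooth {F' : Type*} [NormedAddCommGroup F'] [NormedSpace ℝ F'] {S : Set ℝ}
    (c : ℝ) {f : ℝ → T3 → F'} (hf : Torus.IsSmoothSpaceTimeOn S f) :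
    Torus.IsSmoothSpaceTimeOn S (fun r y => (c - r) • f r y) :=
  (Torus.isSmoothSpaceTimeOn_of_contDiff
    (show ContDiff ℝ ((⊤ : ℕ∞) : WithTop ℕ∞) (fun p : ℝ × EuclideanSpace ℝ (Fin 3) => c - p.1) from
      contDiff_const.sub contDiff_fst) S).smul hf

/-- **The time-weighted row and its window data.** For `f` jointly smooth on `[0, t') × 𝕋³`,
`t' ≤ T`, and a window `[s, s+τ]`, `0 ≤ s`, `s + τ < t'`: the weighted row `(r, y) ↦ (s+τ-r) • f r y`
is jointly smooth on `[s, s+τ] × 𝕋³`; its one-sided time derivative within the window is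
`-f + (s+τ-r) • ∂ₜ^{[0,T)} f` (product rule, `HasDerivWithinAt.smul`, and
`timeDerivWithin_Ico_eq_of_le`); its slices are smooth and its window time derivative and spatial
partial derivatives are jointly continuous on `[s, s+τ] × 𝕋³`. [folklore] -/
theorem xs_weighted {F' : Type*} [NormedAddCommGroup F'] [NormedSpace ℝ F'] {T t' s τ : ℝ}
    {f : ℝ → T3 → F'} (hf : Torus.IsSmoothSpaceTimeOn (Set.Ico 0 t') f) (ht'T : t' ≤ T)
    (hs : 0 ≤ s) (hτ : 0 < τ) (hst' : s + τ < t') :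
    Torus.IsSmoothSpaceTimeOn (Set.Icc s (s + τ)) (fun r y => (s + τ - r) • f r y) ∧
    (∀ r ∈ Set.Icc s (s + τ), ∀ x,
      Torus.timeDerivWithin (Set.Icc s (s + τ)) (fun r y => (s + τ - r) • f r y) r x =
        -(f r x) + (s + τ - r) • Torus.timeDerivWithin (Set.Ico 0 T) f r x) ∧
    (∀ r ∈ Set.Icc s (s + τ), Torus.IsSmooth ((fun r y => (s + τ - r) • f r y) r)) ∧
    ContinuousOn (fun p : ℝ × T3 =>
        Torus.timeDerivWithin (Set.Icc s (s + τ)) (fun r y => (s + τ - r) • f r y) p.1 p.2)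
      (Set.Icc s (s + τ) ×ˢ Set.univ) ∧
    ∀ i, ContinuousOn (fun p : ℝ × T3 =>
        Torus.partialDeriv i ((fun r y => (s + τ - r) • f r y) p.1) p.2)
      (Set.Icc s (s + τ) ×ˢ Set.univ) := by
  have hsτ : s < s + τ := by linarith
  have hsub : Set.Icc s (s + τ) ⊆ Set.Ico 0 t' := fun r hr => ⟨hs.trans hr.1, hr.2.trans_lt hst'⟩
  have hsm : Torus.IsSmoothSpaceTimeOn (Set.Icc s (s + τ)) (fun r y => (s + τ - r) • f r y) :=
    xs_weightedRow_smooth (s + τ) (hf.mono hsub)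
  have hU : UniqueDiffOn ℝ (Set.Icc s (s + τ)) := uniqueDiffOn_Icc hsτ
  refine ⟨hsm, fun r hr x => ?_, fun r hr => hsm.isSmooth_slice hr,
    wd_continuousOn_uncurry_of_isSmoothSpaceTimeOn (hsm.timeDerivWithin hU) Subset.rfl,
    fun i => wd_continuousOn_uncurry_of_isSmoothSpaceTimeOn (hsm.partialDeriv hU i) Subset.rfl⟩
  have h2 : HasDerivWithinAt (fun r' => f r' x) (Torus.timeDerivWithin (Set.Ico 0 t') f r x)
      (Set.Icc s (s + τ)) r :=
    (hf.hasDerivWithinAt_slice (hsub hr) x).mono hsub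
  have h1 : HasDerivWithinAt (fun r' : ℝ => s + τ - r') (-1) (Set.Icc s (s + τ)) r :=
    (hasDerivWithinAt_id (x := r) (s := Set.Icc s (s + τ))).const_sub (s + τ)
  have h12 : HasDerivWithinAt (fun r' => (s + τ - r') • f r' x)
      ((s + τ - r) • Torus.timeDerivWithin (Set.Ico 0 t') f r x + (-1 : ℝ) • f r x)
      (Set.Icc s (s + τ)) r := h1.smul h2
  have h := h12.derivWithin (hU r hr)
  rw [timeDerivWithin_Ico_eq_of_le ht'T f (hsub hr) x] at h
  rw [show Torus.timeDerivWithin (Set.Icc s (s + τ)) (fun r y => (s + τ - r) • f r y) r x =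
      derivWithin (fun r' => (s + τ - r') • f r' x) (Set.Icc s (s + τ)) r from rfl, h, neg_one_smul,
    add_comm]

/-- Scalar version of `xs_weighted` (the weight acting by multiplication). [folklore] -/
theorem xs_weighted_mul {T t' s τ : ℝ} {f : ℝ → T3 → ℝ}
    (hf : Torus.IsSmoothSpaceTimeOn (Set.Ico 0 t') f) (ht'T : t' ≤ T) (hs : 0 ≤ s) (hτ : 0 < τ)
    (hst' : s + τ < t') :
    Torus.IsSmoothSpaceTimeOn (Set.Icc s (s + τ)) (fun r y => (s + τ - r) * f r y) ∧
    (∀ r ∈ Set.Icc s (s + τ), ∀ x,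
      Torus.timeDerivWithin (Set.Icc s (s + τ)) (fun r y => (s + τ - r) * f r y) r x =
        -(f r x) + (s + τ - r) * Torus.timeDerivWithin (Set.Ico 0 T) f r x) ∧
    (∀ r ∈ Set.Icc s (s + τ), Torus.IsSmooth ((fun r y => (s + τ - r) * f r y) r)) ∧
    ContinuousOn (fun p : ℝ × T3 =>
        Torus.timeDerivWithin (Set.Icc s (s + τ)) (fun r y => (s + τ - r) * f r y) p.1 p.2)
      (Set.Icc s (s + τ) ×ˢ Set.univ) ∧
    ∀ i, ContinuousOn (fun p : ℝ × T3 =>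
        Torus.partialDeriv i ((fun r y => (s + τ - r) * f r y) p.1) p.2)
      (Set.Icc s (s + τ) ×ˢ Set.univ) := by
  have h := xs_weighted (T := T) hf ht'T hs hτ hst'
  simp only [smul_eq_mul] at h
  exact h

/-! ### Continuity on slabs and interval integrability of the raw pairings along an orbit -/

/-- **Slab continuity.** For a field jointly smooth on `[0, t') × 𝕋³`, `t' ≤ T`, and `[a, b] ⊆ [0, t')`:
the field, its one-sided time derivative within `[0, T)` and its spatial partial derivatives are
jointly continuous on `[a, b] × 𝕋³` (derivatives of jointly smooth fields are jointly smooth; the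
time derivatives within `[0, t')` and `[0, T)` agree). [folklore] -/
theorem xs_slab {F' : Type*} [NormedAddCommGroup F'] [NormedSpace ℝ F'] {T t' a b : ℝ}
    {f : ℝ → T3 → F'} (hf : Torus.IsSmoothSpaceTimeOn (Set.Ico 0 t') f) (ht'T : t' ≤ T)
    (ha : 0 ≤ a) (hb : b < t') :
    ContinuousOn (Function.uncurry f) (Set.Icc a b ×ˢ Set.univ) ∧
    ContinuousOn (fun p : ℝ × T3 => Torus.timeDerivWithin (Set.Ico 0 T) f p.1 p.2)
      (Set.Icc a b ×ˢ Set.univ) ∧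
    ∀ k, ContinuousOn (fun p : ℝ × T3 => Torus.partialDeriv k (f p.1) p.2) (Set.Icc a b ×ˢ Set.univ) := by
  have hU : UniqueDiffOn ℝ (Set.Ico (0 : ℝ) t') := uniqueDiffOn_Ico 0 t'
  have hsub : Set.Icc a b ⊆ Set.Ico 0 t' := fun r hr => ⟨ha.trans hr.1, hr.2.trans_lt hb⟩
  refine ⟨wd_continuousOn_uncurry_of_isSmoothSpaceTimeOn hf hsub, ?_,
    fun k => wd_continuousOn_uncurry_of_isSmoothSpaceTimeOn (hf.partialDeriv hU k) hsub⟩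
  refine (wd_continuousOn_uncurry_of_isSmoothSpaceTimeOn (hf.timeDerivWithin hU) hsub).congr
    fun p hp => ?_
  exact (timeDerivWithin_Ico_eq_of_le ht'T f (hsub (Set.mem_prod.1 hp).1) p.2).symm

variable {ε : ℝ} {n : ℕ}

/-- Along a good orbit, the raw density pairing `r ↦ ρ_{Φ_r z}[f_r]` with a test jointly continuous on
`[a, b] × 𝕋³` is interval integrable (`intervalIntegrable_sum_orbit` with `G = 1`). [folklore] -/
theorem xs_ii_density (Φ : HardSphereFlow (Torus.geometry (Fin 3)) ε n) {z : Config n (Fin 3) T3}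
    (hz : z ∈ Φ.good) {a b : ℝ} (hab : a ≤ b) {f : ℝ → T3 → ℝ}
    (hf : ContinuousOn (Function.uncurry f) (Set.Icc a b ×ˢ Set.univ)) :
    IntervalIntegrable (fun r => empiricalDensityField (Φ.flow r z) (f r)) volume a b := by
  have h := (intervalIntegrable_sum_orbit Φ hz hab hf (continuous_const (y := (1 : ℝ)))).const_mul
    ((n : ℝ)⁻¹)
  simp only [mul_one] at h
  simpa only [empiricalDensityField_eq_sum] using h

/-- Along a good orbit, the raw energy pairing `r ↦ e_{Φ_r z}[f_r]` with a test jointly continuous on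
`[a, b] × 𝕋³` is interval integrable (`G = ‖·‖²/2`). [folklore] -/
theorem xs_ii_energy (Φ : HardSphereFlow (Torus.geometry (Fin 3)) ε n) {z : Config n (Fin 3) T3}
    (hz : z ∈ Φ.good) {a b : ℝ} (hab : a ≤ b) {f : ℝ → T3 → ℝ}
    (hf : ContinuousOn (Function.uncurry f) (Set.Icc a b ×ˢ Set.univ)) :
    IntervalIntegrable (fun r => empiricalEnergyField (Φ.flow r z) (f r)) volume a b := by
  have hG : Continuous fun v : V3 => ‖v‖ ^ 2 / 2 := (continuous_norm.pow 2).div_const 2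
  have h := (intervalIntegrable_sum_orbit Φ hz hab hf hG).const_mul ((n : ℝ)⁻¹)
  simpa only [empiricalEnergyField_eq_sum] using h

/-- Along a good orbit, the raw momentum pairing `r ↦ Σⱼ (m_{Φ_r z}[g_{j,r}])ⱼ` with tests jointly
continuous on `[a, b] × 𝕋³` is interval integrable (`G = v ↦ vⱼ`). [folklore] -/
theorem xs_ii_momentum (Φ : HardSphereFlow (Torus.geometry (Fin 3)) ε n) {z : Config n (Fin 3) T3}
    (hz : z ∈ Φ.good) {a b : ℝ} (hab : a ≤ b) {g : Fin 3 → ℝ → T3 → ℝ}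
    (hg : ∀ j, ContinuousOn (Function.uncurry (g j)) (Set.Icc a b ×ˢ Set.univ)) :
    IntervalIntegrable (fun r => ∑ j, (empiricalMomentumField (Φ.flow r z) (g j r)) j) volume a b := by
  have h : ∀ j, IntervalIntegrable (fun r => (empiricalMomentumField (Φ.flow r z) (g j r)) j)
      volume a b := fun j => by
    have h1 := (intervalIntegrable_sum_orbit Φ hz hab (hg j) (PiLp.continuous_apply 2 _ j)).const_mul
      ((n : ℝ)⁻¹)
    simpa only [empiricalMomentumField_apply_eq_sum] using h1
  have hsum : (fun r => ∑ j, (empiricalMomentumField (Φ.flow r z) (g j r)) j) =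
      ∑ j, fun r => (empiricalMomentumField (Φ.flow r z) (g j r)) j := by
    funext r; simp only [Finset.sum_apply]
  rw [hsum]
  exact IntervalIntegrable.sum _ fun j _ => h j

/-! ### Linearity of the raw pairings in the test -/

/-- `ρ_w[-a + c b] = -ρ_w[a] + c ρ_w[b]`. [folklore] -/
theorem xs_density_lin (w : Config n (Fin 3) T3) (a b : T3 → ℝ) (c : ℝ) :
    empiricalDensityField w (fun y => -(a y) + c * b y) =
      -(empiricalDensityField w a) + c * empiricalDensityField w b := by
  simp only [empiricalDensityField_eq_sum, Finset.sum_add_distrib, Finset.sum_neg_distrib,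
    ← Finset.mul_sum]
  ring

/-- `(m_w[-a + c b])ⱼ = -(m_w[a])ⱼ + c (m_w[b])ⱼ`. [folklore] -/
theorem xs_mom_lin (w : Config n (Fin 3) T3) (a b : T3 → ℝ) (c : ℝ) (j : Fin 3) :
    empiricalMomentumField w (fun y => -(a y) + c * b y) j =
      -(empiricalMomentumField w a j) + c * empiricalMomentumField w b j := by
  simp only [empiricalMomentumField_apply_eq_sum, add_mul, neg_mul, Finset.sum_add_distrib,
    Finset.sum_neg_distrib, mul_assoc, ← Finset.mul_sum]
  ring

/-- `e_w[-a + c b] = -e_w[a] + c e_w[b]`. [folklore] -/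
theorem xs_energy_lin (w : Config n (Fin 3) T3) (a b : T3 → ℝ) (c : ℝ) :
    empiricalEnergyField w (fun y => -(a y) + c * b y) =
      -(empiricalEnergyField w a) + c * empiricalEnergyField w b := by
  simp only [empiricalEnergyField_eq_sum, add_mul, neg_mul, Finset.sum_add_distrib,
    Finset.sum_neg_distrib, mul_assoc, ← Finset.mul_sum]
  ring

/-- `ρ_w[c χ] = c ρ_w[χ]`. [folklore] -/
theorem xs_density_const_mul (w : Config n (Fin 3) T3) (c : ℝ) (χ : T3 → ℝ) :
    empiricalDensityField w (fun y => c * χ y) = c * empiricalDensityField w χ := by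
  simp only [empiricalDensityField]
  exact integral_const_mul _ _

/-! ### The three balance rows with the time-weighted tests -/

/-- **Registered intermediate `weightedCell_massRow`: the mass row with the time-weighted test** (exact). For a scalar row `λ⁰` jointly smooth on
`[0, t') × 𝕋³`, `t' ≤ T`, a good orbit and a window `[s, s+τ]`, `0 ≤ s`, `s + τ < t'`:
`0 − τ ρ_{Φ_s z}[λ⁰_s] = ∫_s^{s+τ} (−ρ_{Φ_r z}[λ⁰_r] + (s+τ−r)(ρ[∂ₜλ⁰_r] + Σₖ (m[∂ₖλ⁰_r])ₖ)) dr` with an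
interval integrable integrand: `wc_densityRow` for the test `(s+τ−r) λ⁰_r` (smooth on `[0, t') × 𝕋³`),
whose `[0, T)`-time derivative on the window is `−λ⁰ + (s+τ−r) ∂ₜλ⁰` (`wc_timeDerivWithin_window`,
`xs_weighted_mul`) and whose spatial derivatives are `(s+τ−r) ∂ₖλ⁰`. [cite: Yau1991, §2] -/
theorem weightedCell_massRow : ∀ {ε : ℝ} {n : ℕ} {T t' s τ : ℝ} {lam0 : ℝ → T3 → ℝ} (Φ : HardSphereFlow (Torus.geometry (Fin 3)) ε n) {z : Config n (Fin 3) T3}, z ∈ Φ.good → Torus.IsSmoothSpaceTimeOn (Set.Ico 0 t') lam0 → t' ≤ T → 0 ≤ s → 0 < τ → s + τ < t' → IntervalIntegrable (fun r => -(empiricalDensityField (Φ.flow r z) (lam0 r)) + (s + τ - r) * (empiricalDensityField (Φ.flow r z) (Torus.timeDerivWithin (Set.Ico 0 T) lam0 r) + ∑ k, (empiricalMomentumField (Φ.flow r z) (Torus.partialDeriv k (lam0 r))) k)) volume s (s + τ) ∧ 0 - τ * empiricalDensityField (Φ.flow s z) (lam0 s) = ∫ r in s..(s + τ), (-(empiricalDensityField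 (Φ.flow r z) (lam0 r)) + (s + τ - r) * (empiricalDensityField (Φ.flow r z) (Torus.timeDerivWithin (Set.Ico 0 T) lam0 r) + ∑ k, (empiricalMomentumField (Φ.flow r z) (Torus.partialDeriv k (lam0 r))) k)) := by
  intro ε n T t' s τ lam0 Φ z hz h0 ht'T hs hτ hst'
  have hsτ : s ≤ s + τ := by linarith
  have hφ : Torus.IsSmoothSpaceTimeOn (Set.Ico 0 t') (fun r y => (s + τ - r) * lam0 r y) := by
    simpa only [smul_eq_mul] using xs_weightedRow_smooth (s + τ) h0
  obtain ⟨hint, heq⟩ := wc_densityRow Φ hz ht'T hφ hs hsτ hst'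
  obtain ⟨-, hder, -⟩ := xs_weighted_mul (T := T) h0 ht'T hs hτ hst'
  have hpt : EqOn
      (fun r => (n : ℝ)⁻¹ * ∑ i, (Torus.timeDerivWithin (Set.Ico 0 T)
          (fun r y => (s + τ - r) * lam0 r y) r ((Φ.flow r z) i).1 +
        ∑ k, Torus.partialDeriv k (fun y => (s + τ - r) * lam0 r y) ((Φ.flow r z) i).1 *
          ((Φ.flow r z) i).2 k))
      (fun r => -(empiricalDensityField (Φ.flow r z) (lam0 r)) + (s + τ - r) *
        (empiricalDensityField (Φ.flow r z) (Torus.timeDerivWithin (Set.Ico 0 T) lam0 r) +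
          ∑ k, (empiricalMomentumField (Φ.flow r z) (Torus.partialDeriv k (lam0 r))) k))
      (Set.Icc s (s + τ)) := by
    intro r hr
    have e1 : ∀ x, Torus.timeDerivWithin (Set.Ico 0 T) (fun r y => (s + τ - r) * lam0 r y) r x =
        -(lam0 r x) + (s + τ - r) * Torus.timeDerivWithin (Set.Ico 0 T) lam0 r x := fun x => by
      rw [← wc_timeDerivWithin_window hφ hs hτ hst' ht'T hr x, hder r hr x]
    have e2 : ∀ k x, Torus.partialDeriv k (fun y => (s + τ - r) * lam0 r y) x =
        (s + τ - r) * Torus.partialDeriv k (lam0 r) x := fun k x =>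
      DenseExcursionAthermalScaling.partialDeriv_const_mul _ _ _ _
    simp only [e1, e2]
    rw [wc_density_integrand_eq (Φ.flow r z)
      (fun x => -(lam0 r x) + (s + τ - r) * Torus.timeDerivWithin (Set.Ico 0 T) lam0 r x)
      (fun k x => (s + τ - r) * Torus.partialDeriv k (lam0 r) x), xs_density_lin]
    simp only [we_empiricalMomentumField_const_mul, PiLp.smul_apply, smul_eq_mul, ← Finset.mul_sum]
    ring
  have hb1 : empiricalDensityField (Φ.flow (s + τ) z) (fun y => (s + τ - (s + τ)) * lam0 (s + τ) y) = 0 := by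
    simp [empiricalDensityField_eq_sum]
  have hb0 : empiricalDensityField (Φ.flow s z) (fun y => (s + τ - s) * lam0 s y) =
      τ * empiricalDensityField (Φ.flow s z) (lam0 s) := by
    rw [add_sub_cancel_left, xs_density_const_mul]
  refine ⟨?_, ?_⟩
  · rw [intervalIntegrable_iff_integrableOn_Icc_of_le hsτ] at hint ⊢
    exact hint.congr_fun hpt measurableSet_Icc
  · rw [hb1, hb0] at heq
    rw [heq]
    exact intervalIntegral.integral_congr fun r hr => hpt (by rwa [Set.uIcc_of_le hsτ] at hr)

/-- **The momentum-row integrand with the time-weighted test, pointwise in time.** If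
`ψ_r = c • λ_r` and `∂ₜ^{S} ψ (r, ·) = −λ_r + c • ∂ₜ^{S'} λ (r, ·)`, then the time integrand of
`momDefect` at time `r` (raw momentum against `∂ₜψ_r` plus the Euler momentum flux of the ball averages
against `∇ψ_r, div ψ_r`) equals `−Σⱼ(m_w[λ_{r,j}])ⱼ + c · (Σⱼ(m_w[∂ₜλ_{r,j}])ⱼ + ∫ flux(λ_r))`
(linearity; `∂ᵢ(c•λ) = c•∂ᵢλ`, `div(c•λ) = c div λ`). [folklore] -/
theorem xs_mom_integrand {σ : ℝ} (w : Config n (Fin 3) T3) (ℓ : ℝ) {S S' : Set ℝ}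
    {ψ lam : ℝ → T3 → V3} {r c : ℝ} (hψ : ψ r = fun y => c • lam r y)
    (hder : ∀ y, Torus.timeDerivWithin S ψ r y = -(lam r y) + c • Torus.timeDerivWithin S' lam r y) :
    (∑ j, (empiricalMomentumField w (fun y => Torus.timeDerivWithin S ψ r y j)) j) +
      ∫ x, ((∑ i, ∑ j, (Torus.partialDeriv i (ψ r) x) j *
          (empiricalMomentumField w (ballKernel ℓ x) i * empiricalMomentumField w (ballKernel ℓ x) j /
            empiricalDensityField w (ballKernel ℓ x))) +
        hsPressure σ (empiricalDensityField w (ballKernel ℓ x))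
          (2 / 3 * (empiricalEnergyField w (ballKernel ℓ x) / empiricalDensityField w (ballKernel ℓ x) -
            ‖empiricalMomentumField w (ballKernel ℓ x)‖ ^ 2 /
              (2 * empiricalDensityField w (ballKernel ℓ x) ^ 2))) *
          Torus.divergence (ψ r) x) =
    -(∑ j, (empiricalMomentumField w (fun y => lam r y j)) j) +
      c * ((∑ j, (empiricalMomentumField w (fun y => Torus.timeDerivWithin S' lam r y j)) j) +
        ∫ x, ((∑ i, ∑ j, (Torus.partialDeriv i (lam r) x) j *
            (empiricalMomentumField w (ballKernel ℓ x) i * empiricalMomentumField w (ballKernel ℓ x) j /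
              empiricalDensityField w (ballKernel ℓ x))) +
          hsPressure σ (empiricalDensityField w (ballKernel ℓ x))
            (2 / 3 * (empiricalEnergyField w (ballKernel ℓ x) / empiricalDensityField w (ballKernel ℓ x) -
              ‖empiricalMomentumField w (ballKernel ℓ x)‖ ^ 2 /
                (2 * empiricalDensityField w (ballKernel ℓ x) ^ 2))) *
            Torus.divergence (lam r) x)) := by
  have e1 : ∀ j y, Torus.timeDerivWithin S ψ r y j =
      -(lam r y j) + c * Torus.timeDerivWithin S' lam r y j := fun j y => by
    rw [hder y, PiLp.add_apply, PiLp.neg_apply, PiLp.smul_apply, smul_eq_mul]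
  have e2 : ∀ i x, Torus.partialDeriv i (ψ r) x = c • Torus.partialDeriv i (lam r) x := fun i x => by
    rw [hψ]; exact DenseExcursionAthermalScaling.partialDeriv_const_smul c (lam r) i x
  have e3 : ∀ x, Torus.divergence (ψ r) x = c * Torus.divergence (lam r) x := fun x => by
    rw [hψ]; exact DenseExcursionAthermalScaling.divergence_const_smul c (lam r) x
  have hI : (∫ x, ((∑ i, ∑ j, (Torus.partialDeriv i (ψ r) x) j *
          (empiricalMomentumField w (ballKernel ℓ x) i * empiricalMomentumField w (ballKernel ℓ x) j /
            empiricalDensityField w (ballKernel ℓ x))) +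
        hsPressure σ (empiricalDensityField w (ballKernel ℓ x))
          (2 / 3 * (empiricalEnergyField w (ballKernel ℓ x) / empiricalDensityField w (ballKernel ℓ x) -
            ‖empiricalMomentumField w (ballKernel ℓ x)‖ ^ 2 /
              (2 * empiricalDensityField w (ballKernel ℓ x) ^ 2))) *
          Torus.divergence (ψ r) x)) =
      c * ∫ x, ((∑ i, ∑ j, (Torus.partialDeriv i (lam r) x) j *
          (empiricalMomentumField w (ballKernel ℓ x) i * empiricalMomentumField w (ballKernel ℓ x) j /
            empiricalDensityField w (ballKernel ℓ x))) +
        hsPressure σ (empiricalDensityField w (ballKernel ℓ x))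
          (2 / 3 * (empiricalEnergyField w (ballKernel ℓ x) / empiricalDensityField w (ballKernel ℓ x) -
            ‖empiricalMomentumField w (ballKernel ℓ x)‖ ^ 2 /
              (2 * empiricalDensityField w (ballKernel ℓ x) ^ 2))) *
          Torus.divergence (lam r) x) := by
    rw [← integral_const_mul]
    refine integral_congr_ae (ae_of_all _ fun x => ?_)
    simp only [e2, e3, PiLp.smul_apply, smul_eq_mul, mul_add, Finset.mul_sum]
    congr 1
    · exact Finset.sum_congr rfl fun i _ => Finset.sum_congr rfl fun j _ => by ring
    · ring
  rw [hI]
  simp only [e1, xs_mom_lin, Finset.sum_add_distrib, Finset.sum_neg_distrib, ← Finset.mul_sum]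
  ring

/-- **The energy-row integrand with the time-weighted test, pointwise in time.** If `φ_r = c λ⁴_r`
and `∂ₜ^{S} φ (r, ·) = −λ⁴_r + c ∂ₜ^{S'} λ⁴ (r, ·)`, then the time integrand of `enDefect` at time `r`
equals `−e_w[λ⁴_r] + c · (e_w[∂ₜλ⁴_r] + ∫ (ẽ + p̃) Σᵢ (m̃ᵢ/ρ̃)(∇λ⁴_r)ᵢ)` (`∇(cλ⁴) = c∇λ⁴`). [folklore] -/
theorem xs_en_integrand {σ : ℝ} (w : Config n (Fin 3) T3) (ℓ : ℝ) {S S' : Set ℝ}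
    {φ lam4 : ℝ → T3 → ℝ} {r c : ℝ} (hφ : φ r = fun y => c * lam4 r y)
    (hder : ∀ y, Torus.timeDerivWithin S φ r y = -(lam4 r y) + c * Torus.timeDerivWithin S' lam4 r y) :
    empiricalEnergyField w (Torus.timeDerivWithin S φ r) +
      ∫ x, (empiricalEnergyField w (ballKernel ℓ x) +
          hsPressure σ (empiricalDensityField w (ballKernel ℓ x))
            (2 / 3 * (empiricalEnergyField w (ballKernel ℓ x) / empiricalDensityField w (ballKernel ℓ x) -
              ‖empiricalMomentumField w (ballKernel ℓ x)‖ ^ 2 /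
                (2 * empiricalDensityField w (ballKernel ℓ x) ^ 2)))) *
        (∑ i, (empiricalMomentumField w (ballKernel ℓ x) i / empiricalDensityField w (ballKernel ℓ x)) *
          (Torus.gradient (φ r) x) i) =
    -(empiricalEnergyField w (lam4 r)) +
      c * (empiricalEnergyField w (Torus.timeDerivWithin S' lam4 r) +
        ∫ x, (empiricalEnergyField w (ballKernel ℓ x) +
            hsPressure σ (empiricalDensityField w (ballKernel ℓ x))
              (2 / 3 * (empiricalEnergyField w (ballKernel ℓ x) / empiricalDensityField w (ballKernel ℓ x) -
                ‖empiricalMomentumField w (ballKernel ℓ x)‖ ^ 2 /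
                  (2 * empiricalDensityField w (ballKernel ℓ x) ^ 2)))) *
          (∑ i, (empiricalMomentumField w (ballKernel ℓ x) i / empiricalDensityField w (ballKernel ℓ x)) *
            (Torus.gradient (lam4 r) x) i)) := by
  have e1 : Torus.timeDerivWithin S φ r =
      fun y => -(lam4 r y) + c * Torus.timeDerivWithin S' lam4 r y := funext hder
  have e2 : ∀ x i, (Torus.gradient (φ r) x) i = c * (Torus.gradient (lam4 r) x) i := fun x i => by
    rw [hφ, DenseExcursionAthermalScaling.gradient_const_mul c (lam4 r) x, PiLp.smul_apply, smul_eq_mul]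
  have hI : (∫ x, (empiricalEnergyField w (ballKernel ℓ x) +
          hsPressure σ (empiricalDensityField w (ballKernel ℓ x))
            (2 / 3 * (empiricalEnergyField w (ballKernel ℓ x) / empiricalDensityField w (ballKernel ℓ x) -
              ‖empiricalMomentumField w (ballKernel ℓ x)‖ ^ 2 /
                (2 * empiricalDensityField w (ballKernel ℓ x) ^ 2)))) *
        (∑ i, (empiricalMomentumField w (ballKernel ℓ x) i / empiricalDensityField w (ballKernel ℓ x)) *
          (Torus.gradient (φ r) x) i)) =
      c * ∫ x, (empiricalEnergyField w (ballKernel ℓ x) +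
          hsPressure σ (empiricalDensityField w (ballKernel ℓ x))
            (2 / 3 * (empiricalEnergyField w (ballKernel ℓ x) / empiricalDensityField w (ballKernel ℓ x) -
              ‖empiricalMomentumField w (ballKernel ℓ x)‖ ^ 2 /
                (2 * empiricalDensityField w (ballKernel ℓ x) ^ 2)))) *
        (∑ i, (empiricalMomentumField w (ballKernel ℓ x) i / empiricalDensityField w (ballKernel ℓ x)) *
          (Torus.gradient (lam4 r) x) i) := by
    rw [← integral_const_mul]
    refine integral_congr_ae (ae_of_all _ fun x => ?_)
    have hs : ∑ i, (empiricalMomentumField w (ballKernel ℓ x) i / empiricalDensityField w (ballKernel ℓ x)) *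
          (Torus.gradient (φ r) x) i =
        c * ∑ i, (empiricalMomentumField w (ballKernel ℓ x) i / empiricalDensityField w (ballKernel ℓ x)) *
          (Torus.gradient (lam4 r) x) i := by
      rw [Finset.mul_sum]
      exact Finset.sum_congr rfl fun i _ => by rw [e2]; ring
    beta_reduce
    rw [hs]
    ring
  rw [hI, e1, xs_energy_lin]
  ring

end Summit.AtomisticToContinuum.HydrodynamicLimit.Theorems.NearConstantShortTimeHL

end
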